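import Summits.AtomisticToContinuum.BoseEinsteinCondensation.Theorems.BECCutLineWeakDisorderWitnessTransferHeig
import Summits.AtomisticToContinuum.BoseEinsteinCondensation.Theorems.TwoReplicaTransienceBound.Negative.ConstantAtLeastOne
import HarnessLib

/-!
# Crux `TwoReplicaTransienceBound` (stmt-AtomisticToContinuum-9687): the PER-BOX bound

Support file (does not close the item) for the crux
`Summit.AtomisticToContinuum.BoseEinsteinCondensation.Theses.BECCutLineWeakDisorder.TwoReplicaTransienceBound`
(route `BECCutLineWeakDisorder`, line `SketchIdeator1`, lead c2).

The crux asks, for admissible `v`, small `ρ`, eventually in `n` and UNIFORMLY in the polymer length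
`T ≥ 1`, for `∫ L³ m_T(Y)²/s_T(Y)² dY ≤ C` with `Ψ_T = fkWitness v L T 1 = e^{-TH_N}1/‖e^{-TH_N}1‖₂`
(`L = sideLength ρ (n+1)`, `m_T(Y) = ∫Ψ_T(x::Y)²dx`, `s_T(Y) = ∫Ψ_T(x::Y)dx`). This file proves the
statement BOX BY BOX: for every measurable pair potential `v : ℝ → [0, ∞]` (hard cores allowed) and every
box in which the flat-datum partition norm `Z(2) = ‖e^{-2H_N}1‖₂²` does not vanish — in particular for
every BOUNDED `v`, every `L > 0` and every particle number — there is `C = C(v, n, L) < ∞` with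
`∫ L³ m_T²/s_T² dY ≤ C` for ALL `T ≥ 1` (`twoReplicaTransienceBound_perBox`). No ground state, no
spectral theorem and no positivity improving enter: the uniformity in `T` is carried by

* `fkSemigroup_one_sq_le` — the `L² → L^∞` smoothing at time one,
  `Z_T(X)² = (e^{-H_N} Z_{T-1})(X)² ≤ κ ‖Z_{T-1}‖₂²` (`fkSemigroup_le_L2`, Chung–Zhao Thm 3.17), and
* `fkNormSq_sub_one_mul_two_le` — **log-convexity of `T ↦ Z(T) = ‖e^{-TH_N}1‖₂²`** in the usable form
  `Z(T-1)·Z(2) ≤ Z(0)·Z(T)` for `T ≥ 1` (midpoint log-convexity `fkNormSq_one_midpoint_sq_le` —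
  Cauchy–Schwarz, symmetry, semigroup law — iterated down the ladder `T, T-1, …` into `[1,2)`, where
  monotonicity `fkNormSq_one_antitone` closes it),

whence `Ψ_T(X)² = Z_T(X)²/Z(T) ≤ κ Z(0)/Z(2)` for all `T ≥ 1` and all `X`
(`ofReal_fkWitness_one_sq_le`, `fkWitness_one_le_of_ne_zero` — a ground-state-free version of
`CutLineWitness.fkWitness_one_le`, valid for hard cores as soon as the box is non-vacuous), and the
slice algebra `m ≤ K s ⇒ L³m²/s² ≤ L³K²` on `Λ_L^n` (`lintegral_ratio_fkWitness_one_le`).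

What this certifies for the line: the ENTIRE content of the crux is the uniformity of the constant in
the particle number `n` (for bounded `v`; for hard cores, modulo non-vacuity of the box at low density).
In particular the crux's `∀ᶠ n` and an `∀ n` reading differ by nothing, and no attack on the crux
through a fixed box and `T → ∞` can succeed (contrast: the annealed engine `stub_tracerSecondMoment` of
the line's v1 skeleton, which IS false box by box, `Cruxes/TwoReplicaTransienceBound/Disproof.lean`).

## References

* B. Simon, *Schrödinger semigroups*, Bull. AMS 7 (1982), §A1 (A7) (the approximants
  `e^{-tH}f/(f, e^{-2tH}f)^{1/2}`; log-convexity of `t ↦ (f, e^{-tH}f)`). [Simon1982]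
* K. L. Chung, Z. Zhao, *From Brownian Motion to Schrödinger's Equation* (1995), Thm 3.10 (symmetry),
  Thm 3.17 (`T_t : L² → L^∞`). [ChungZhao1995]
-/

noncomputable section

open MeasureTheory Filter Set
open scoped ENNReal NNReal Topology

namespace Summit.AtomisticToContinuum.BoseEinsteinCondensation.Cruxes.TwoReplicaTransienceBound.PerBox

open Literature.MathematicalPhysics.QuantumManyBody.BoseGas
open Summit.AtomisticToContinuum.BoseEinsteinCondensation.Theorems.CutLineWitness

variable {N : ℕ}

/-! ### Log-convexity of the partition norm, in ladder form -/

/-- **`Z(T-1)·Z(2) ≤ Z(0)·Z(T)` for `T ≥ 1`**, where `Z(s) = ‖e^{-sH_N}1‖₂² = fkNormSq v L s 1`, for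
every measurable pair potential (hard cores allowed). If `Z(2) = 0` this is trivial; otherwise `Z > 0`
on `[0, ∞)` (`fkNormSq_one_ne_zero`) and one descends the ladder: for `T ∈ [1, 2)` it is monotonicity
(`Z(T-1) ≤ Z(0)`, `Z(2) ≤ Z(T)`), and for `T ≥ 2` midpoint log-convexity `Z(T-1)² ≤ Z(T-2) Z(T)`
(`fkNormSq_one_midpoint_sq_le`) reduces `T` to `T - 1` after cancelling the finite nonzero `Z(T-1)`.
[cite: Simon1982, §A1 (A7) p. 449] -/
theorem fkNormSq_sub_one_mul_two_le {v : ℝ → ℝ≥0∞} (hv : Measurable v) (L : ℝ) {T : ℝ}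
    (hT : 1 ≤ T) :
    fkNormSq (N := N) v L (T - 1) (fun _ => (1 : ℝ≥0∞)) *
        fkNormSq (N := N) v L 2 (fun _ => (1 : ℝ≥0∞)) ≤
      fkNormSq (N := N) v L 0 (fun _ => (1 : ℝ≥0∞)) *
        fkNormSq (N := N) v L T (fun _ => (1 : ℝ≥0∞)) := by
  obtain ⟨Z, hZ⟩ : ∃ Z : ℝ → ℝ≥0∞, ∀ s, Z s = fkNormSq (N := N) v L s (fun _ => (1 : ℝ≥0∞)) :=
    ⟨_, fun _ => rfl⟩
  simp only [← hZ]
  by_cases h2 : Z 2 = 0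
  · simp [h2]
  have h2' : fkNormSq (N := N) v L 2 (fun _ => (1 : ℝ≥0∞)) ≠ 0 := by rwa [← hZ]
  have hne : ∀ s : ℝ, 0 ≤ s → Z s ≠ 0 := fun s hs => by
    rw [hZ]; exact fkNormSq_one_ne_zero hv L two_pos h2' hs
  have htop : ∀ s : ℝ, 0 ≤ s → Z s ≠ ⊤ := fun s hs => by
    rw [hZ]; exact ne_top_of_le_ne_top (volume_boxN_lt_top N L).ne (fkNormSq_one_le v hs)
  have hanti : ∀ a b : ℝ, 0 ≤ a → a ≤ b → Z b ≤ Z a := fun a b ha hab => by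
    rw [hZ, hZ]; exact fkNormSq_one_antitone hv L ha hab
  have hmid : ∀ a b : ℝ, 0 ≤ a → 0 ≤ b → Z ((a + b) / 2) ^ 2 ≤ Z a * Z b := fun a b ha hb => by
    rw [hZ, hZ, hZ]; exact fkNormSq_one_midpoint_sq_le hv L ha hb
  -- the ladder: `T ∈ [1 + k, 2 + k)`
  have key : ∀ k : ℕ, ∀ T : ℝ, 1 + k ≤ T → T < 2 + k → Z (T - 1) * Z 2 ≤ Z 0 * Z T := by
    intro k
    induction k with
    | zero =>
      intro T h1 hlt
      simp only [Nat.cast_zero, add_zero] at h1 hlt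
      exact mul_le_mul' (hanti 0 (T - 1) le_rfl (by linarith)) (hanti T 2 (by linarith) hlt.le)
    | succ k ih =>
      intro T h1 hlt
      push_cast at h1 hlt
      have hk : (0 : ℝ) ≤ k := Nat.cast_nonneg k
      have hT2 : 0 ≤ T - 2 := by linarith
      have hm := hmid (T - 2) T hT2 (by linarith)
      rw [show (T - 2 + T) / 2 = T - 1 by ring] at hm
      have hih := ih (T - 1) (by linarith) (by linarith)
      rw [show T - 1 - 1 = T - 2 by ring] at hih
      have h3 : Z (T - 1) * (Z (T - 1) * Z 2) ≤ Z (T - 1) * (Z 0 * Z T) :=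
        calc Z (T - 1) * (Z (T - 1) * Z 2) = Z (T - 1) ^ 2 * Z 2 := by ring
          _ ≤ Z (T - 2) * Z T * Z 2 := mul_le_mul' hm le_rfl
          _ = Z (T - 2) * Z 2 * Z T := by ring
          _ ≤ Z 0 * Z (T - 1) * Z T := mul_le_mul' hih le_rfl
          _ = Z (T - 1) * (Z 0 * Z T) := by ring
      exact (ENNReal.mul_le_mul_iff_right (hne _ (by linarith)) (htop _ (by linarith))).1 h3
  have h0 : 0 ≤ T - 1 := by linarith
  refine key ⌊T - 1⌋₊ T ?_ ?_
  · have := Nat.floor_le h0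
    linarith
  · have := Nat.lt_floor_add_one (T - 1)
    linarith

/-! ### The `L² → L^∞` smoothing at time one -/

/-- **`Z_T(X)² ≤ κ ‖Z_{T-1}‖₂²` for all `T ≥ 1` and all `X`**, with one finite constant `κ = κ(N)`:
`Z_T = e^{-H_N} Z_{T-1}` (semigroup law) and the `L² → L^∞` bound of the Feynman–Kac functional at
time one (`fkSemigroup_le_L2`). [cite: ChungZhao1995, Thm 3.17] -/
theorem fkSemigroup_one_sq_le {v : ℝ → ℝ≥0∞} (hv : Measurable v) (L : ℝ) :
    ∃ κ : ℝ≥0∞, κ ≠ ⊤ ∧ ∀ T : ℝ, 1 ≤ T → ∀ X : Config N,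
      fkSemigroup v L T (fun _ => (1 : ℝ≥0∞)) X ^ 2 ≤
        κ * fkNormSq (N := N) v L (T - 1) (fun _ => (1 : ℝ≥0∞)) := by
  obtain ⟨κ, hκt, hκ⟩ := exists_fkSemigroup_one_le_L2 (N := N) v L
  refine ⟨κ ^ 2, ENNReal.pow_ne_top hκt, fun T hT X => ?_⟩
  have hT1 : 0 ≤ T - 1 := by linarith
  have hmeasT : Measurable (fkSemigroup v L (T - 1) fun _ : Config N => (1 : ℝ≥0∞)) :=
    measurable_fkSemigroup hv L (T - 1) measurable_const
  have hsplit : fkSemigroup v L T (fun _ => (1 : ℝ≥0∞)) X =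
      fkSemigroup v L 1 (fkSemigroup v L (T - 1) fun _ => (1 : ℝ≥0∞)) X := by
    have := fkSemigroup_add hv L zero_le_one hT1
      (measurable_const : Measurable fun _ : Config N => (1 : ℝ≥0∞)) X
    rwa [add_sub_cancel] at this
  have hsq : (∫⁻ Y : Config N, fkSemigroup v L (T - 1) (fun _ => (1 : ℝ≥0∞)) Y ^ (2 : ℝ)) =
      fkNormSq (N := N) v L (T - 1) (fun _ => (1 : ℝ≥0∞)) := by
    rw [fkNormSq]; exact lintegral_congr fun Y => ENNReal.rpow_two _
  have hhalf : ∀ x : ℝ≥0∞, (x ^ (1 / 2 : ℝ)) ^ 2 = x := fun x => by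
    rw [← ENNReal.rpow_two, ← ENNReal.rpow_mul]
    norm_num
  calc fkSemigroup v L T (fun _ => (1 : ℝ≥0∞)) X ^ 2
      = (fkSemigroup v L 1 (fkSemigroup v L (T - 1) fun _ => (1 : ℝ≥0∞)) X) ^ 2 := by rw [hsplit]
    _ ≤ (κ * (∫⁻ Y : Config N, fkSemigroup v L (T - 1) (fun _ => (1 : ℝ≥0∞)) Y ^ (2 : ℝ)) ^
          (1 / 2 : ℝ)) ^ 2 := pow_le_pow_left' (hκ _ hmeasT X) 2
    _ = κ ^ 2 * fkNormSq (N := N) v L (T - 1) (fun _ => (1 : ℝ≥0∞)) := by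
        rw [mul_pow, hhalf, hsq]

/-! ### The uniform bound on the finite-`T` witnesses, ground-state-free -/

/-- **`Ψ_T(X)² ≤ M < ∞` for all `T ≥ 1` and all `X`**, for every measurable pair potential and every box
with `Z(2) = ‖e^{-2H_N}1‖₂² ≠ 0`: `Ψ_T(X)² = Z_T(X)²/Z(T) ≤ κ Z(T-1)/Z(T) ≤ κ Z(0)/Z(2) =: M`
(`fkSemigroup_one_sq_le` and `fkNormSq_sub_one_mul_two_le`). [folklore] -/
theorem ofReal_fkWitness_one_sq_le {v : ℝ → ℝ≥0∞} (hv : Measurable v) (L : ℝ)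
    (h2 : fkNormSq (N := N) v L 2 (fun _ => (1 : ℝ≥0∞)) ≠ 0) :
    ∃ M : ℝ≥0∞, M ≠ ⊤ ∧ ∀ T : ℝ, 1 ≤ T → ∀ X : Config N,
      ENNReal.ofReal (fkWitness (N := N) v L T (fun _ => (1 : ℝ≥0∞)) X) ^ 2 ≤ M := by
  obtain ⟨κ, hκt, hκ⟩ := fkSemigroup_one_sq_le (N := N) hv L
  set Z0 := fkNormSq (N := N) v L 0 (fun _ => (1 : ℝ≥0∞)) with hZ0
  set Z2 := fkNormSq (N := N) v L 2 (fun _ => (1 : ℝ≥0∞)) with hZ2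
  have hZ0t : Z0 ≠ ⊤ := ne_top_of_le_ne_top (volume_boxN_lt_top N L).ne (fkNormSq_one_le v le_rfl)
  refine ⟨κ * Z0 / Z2, (ENNReal.div_lt_top (ENNReal.mul_ne_top hκt hZ0t) h2).ne, fun T hT X => ?_⟩
  have hT0 : 0 ≤ T := zero_le_one.trans hT
  set ZT := fkNormSq (N := N) v L T (fun _ => (1 : ℝ≥0∞)) with hZT
  have hZTne : ZT ≠ 0 := fkNormSq_one_ne_zero hv L two_pos h2 hT0
  have hZTt : ZT ≠ ⊤ := ne_top_of_le_ne_top (volume_boxN_lt_top N L).ne (fkNormSq_one_le v hT0)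
  have hXt : fkSemigroup v L T (fun _ => (1 : ℝ≥0∞)) X ≠ ⊤ :=
    ((fkPartition_le_one v L T X).trans_lt ENNReal.one_lt_top).ne
  rw [ofReal_fkWitness_sq hXt hZTne]
  -- `Z_T(X)² · Z(2) ≤ κ Z(T-1) Z(2) ≤ κ Z(0) Z(T)`
  have hchain : fkSemigroup v L T (fun _ => (1 : ℝ≥0∞)) X ^ 2 * Z2 ≤ κ * Z0 * ZT :=
    calc fkSemigroup v L T (fun _ => (1 : ℝ≥0∞)) X ^ 2 * Z2
        ≤ κ * fkNormSq (N := N) v L (T - 1) (fun _ => (1 : ℝ≥0∞)) * Z2 :=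
          mul_le_mul' (hκ T hT X) le_rfl
      _ = κ * (fkNormSq (N := N) v L (T - 1) (fun _ => (1 : ℝ≥0∞)) * Z2) := mul_assoc _ _ _
      _ ≤ κ * (Z0 * ZT) := mul_le_mul' le_rfl (fkNormSq_sub_one_mul_two_le hv L hT)
      _ = κ * Z0 * ZT := (mul_assoc _ _ _).symm
  rw [ENNReal.div_le_iff hZTne hZTt]
  have h1 : fkSemigroup v L T (fun _ => (1 : ℝ≥0∞)) X ^ 2 ≤ κ * Z0 * ZT / Z2 :=
    (ENNReal.le_div_iff_mul_le (Or.inl h2) (Or.inr (ENNReal.mul_ne_top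
      (ENNReal.mul_ne_top hκt hZ0t) hZTt))).2 hchain
  calc fkSemigroup v L T (fun _ => (1 : ℝ≥0∞)) X ^ 2 ≤ κ * Z0 * ZT / Z2 := h1
    _ = κ * Z0 / Z2 * ZT := ENNReal.mul_div_right_comm

/-- **Uniform bound on the finite-`T` witnesses, without a ground state**: for every measurable
`v : ℝ → [0, ∞]` (hard cores allowed) and every box with `‖e^{-2H_N}1‖₂² ≠ 0` there is `K` with
`fkWitness v L T 1 X ≤ K` for all `T ≥ 1` and all `X` (compare `CutLineWitness.fkWitness_one_le`,
which needs a bounded `v` and a Feynman–Kac ground state). [folklore] -/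
theorem fkWitness_one_le_of_ne_zero {v : ℝ → ℝ≥0∞} (hv : Measurable v) (L : ℝ)
    (h2 : fkNormSq (N := N) v L 2 (fun _ => (1 : ℝ≥0∞)) ≠ 0) :
    ∃ K : ℝ, 0 ≤ K ∧ ∀ T : ℝ, 1 ≤ T → ∀ X : Config N,
      fkWitness (N := N) v L T (fun _ => (1 : ℝ≥0∞)) X ≤ K := by
  obtain ⟨M, hMt, hM⟩ := ofReal_fkWitness_one_sq_le (N := N) hv L h2
  refine ⟨Real.sqrt M.toReal, Real.sqrt_nonneg _, fun T hT X => ?_⟩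
  have h := ENNReal.toReal_mono hMt (hM T hT X)
  rw [ENNReal.toReal_pow, ENNReal.toReal_ofReal (fkWitness_nonneg v L T _ X)] at h
  exact (le_abs_self _).trans (Real.abs_le_sqrt h)

/-! ### The per-box bound on the crux functional -/

/-- **Per-box bound on the cut-line second-moment functional**: for every measurable pair potential
and every box `Λ_L^{n+1}` with `‖e^{-2H_{n+1}}1‖₂² ≠ 0` there is `C < ∞` with
`∫ L³ m_T(Y)²/s_T(Y)² dY ≤ C` for ALL `T ≥ 1`, `Ψ_T = fkWitness v L T 1` (`|Ψ_T| ≤ K` uniformly, so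
`m_T ≤ K s_T` slice by slice and the integrand is `≤ L³K²` on `Λ_L^n`, `0` off it). [folklore] -/
theorem lintegral_ratio_fkWitness_one_le {n : ℕ} {v : ℝ → ℝ≥0∞} (hv : Measurable v) (L : ℝ)
    (h2 : fkNormSq (N := n + 1) v L 2 (fun _ => (1 : ℝ≥0∞)) ≠ 0) :
    ∃ C : ℝ, 0 < C ∧ ∀ T : ℝ, 1 ≤ T →
      ∫⁻ Y : Config n, ENNReal.ofReal (L ^ 3) *
          (∫⁻ x, (‖fkWitness (N := n + 1) v L T (fun _ => (1 : ℝ≥0∞)) (Matrix.vecCons x Y)‖₊ :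
            ℝ≥0∞) ^ 2) ^ 2 /
          (∫⁻ x, (‖fkWitness (N := n + 1) v L T (fun _ => (1 : ℝ≥0∞)) (Matrix.vecCons x Y)‖₊ :
            ℝ≥0∞)) ^ 2 ≤ ENNReal.ofReal C := by
  obtain ⟨K, -, hK⟩ := fkWitness_one_le_of_ne_zero (N := n + 1) hv L h2
  set B : ℝ≥0∞ := ENNReal.ofReal (L ^ 3) * ENNReal.ofReal K ^ 2 * volume (boxN n L) with hB
  have hBt : B ≠ ⊤ := ENNReal.mul_ne_top
    (ENNReal.mul_ne_top ENNReal.ofReal_ne_top (ENNReal.pow_ne_top ENNReal.ofReal_ne_top))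
    (volume_boxN_lt_top n L).ne
  refine ⟨B.toReal + 1, by positivity, fun T hT => ?_⟩
  have hT0 : 0 ≤ T := zero_le_one.trans hT
  set f := fkWitness (N := n + 1) v L T (fun _ => (1 : ℝ≥0∞)) with hf
  have hbound : ∀ X, |f X| ≤ K := fun X => by
    rw [abs_of_nonneg (fkWitness_nonneg v L T _ X)]; exact hK T hT X
  have hsupp : ∀ X, X ∉ boxN (n + 1) L → f X = 0 := fun X hX => fkWitness_of_notMem v hT0 _ hX
  -- the integrand is dominated by `L³ K²` on the box and vanishes off it
  have hdom : ∀ Y : Config n, ENNReal.ofReal (L ^ 3) *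
      (∫⁻ x, (‖f (Matrix.vecCons x Y)‖₊ : ℝ≥0∞) ^ 2) ^ 2 /
        (∫⁻ x, (‖f (Matrix.vecCons x Y)‖₊ : ℝ≥0∞)) ^ 2 ≤
      (boxN n L).indicator (fun _ => ENNReal.ofReal (L ^ 3) * ENNReal.ofReal K ^ 2) Y := by
    intro Y
    by_cases hY : Y ∈ boxN n L
    · rw [Set.indicator_of_mem hY]
      exact mul_sq_div_sq_le (lintegral_sq_le_mul_lintegral fun x => hbound _)
    · rw [Set.indicator_of_notMem hY]
      have h0 : ∀ x : Space, f (Matrix.vecCons x Y) = 0 :=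
        fun x => hsupp _ fun h => hY (vecCons_mem_boxN_iff.1 h).2
      simp [h0]
  calc ∫⁻ Y : Config n, ENNReal.ofReal (L ^ 3) *
        (∫⁻ x, (‖f (Matrix.vecCons x Y)‖₊ : ℝ≥0∞) ^ 2) ^ 2 /
          (∫⁻ x, (‖f (Matrix.vecCons x Y)‖₊ : ℝ≥0∞)) ^ 2
      ≤ ∫⁻ Y : Config n, (boxN n L).indicator
          (fun _ => ENNReal.ofReal (L ^ 3) * ENNReal.ofReal K ^ 2) Y := lintegral_mono hdom
    _ = B := by
        rw [lintegral_indicator (measurableSet_boxN n L), setLIntegral_const, hB]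
    _ = ENNReal.ofReal B.toReal := (ENNReal.ofReal_toReal hBt).symm
    _ ≤ ENNReal.ofReal (B.toReal + 1) := ENNReal.ofReal_le_ofReal (by linarith)

/-- **The crux `TwoReplicaTransienceBound` holds BOX BY BOX for bounded pair potentials**: for every
admissible BOUNDED `v`, every density `ρ > 0` and EVERY particle number `n`, there is `C = C(v, ρ, n)`
with `∫ L³ m_T(Y)²/s_T(Y)² dY ≤ C` for all `T ≥ 1`, in the crux's own integrand
(`L = sideLength ρ (n+1)`, `Ψ_T = fkWitness v L T 1`; the box is non-vacuous, `‖e^{-2H}1‖₂² ≠ 0`, by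
`Negative.fkNormSq_one_ne_zero`). So the crux's content is exactly the uniformity of `C` in `n`; no
smallness of `ρ` and no finite range are used at fixed `n`. [folklore] -/
theorem twoReplicaTransienceBound_perBox (v : ℝ → ℝ≥0∞) (hv : IsRepulsiveFiniteRange v)
    (hb : ∃ C : ℝ≥0, ∀ r, v r ≤ C) {ρ : ℝ} (hρ : 0 < ρ) (n : ℕ) :
    ∃ C : ℝ, 0 < C ∧ ∀ T : ℝ, 1 ≤ T →
      ∫⁻ Y : Config n, ENNReal.ofReal (sideLength ρ (n + 1) ^ 3) *
          (∫⁻ x, (‖fkWitness (N := n + 1) v (sideLength ρ (n + 1)) T (fun _ => (1 : ℝ≥0∞))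
            (Matrix.vecCons x Y)‖₊ : ℝ≥0∞) ^ 2) ^ 2 /
          (∫⁻ x, (‖fkWitness (N := n + 1) v (sideLength ρ (n + 1)) T (fun _ => (1 : ℝ≥0∞))
            (Matrix.vecCons x Y)‖₊ : ℝ≥0∞)) ^ 2 ≤ ENNReal.ofReal C := by
  obtain ⟨C, hC⟩ := hb
  have hL : 0 < sideLength ρ (n + 1) :=
    Real.rpow_pos_of_pos (div_pos (by exact_mod_cast Nat.succ_pos n) hρ) _
  exact lintegral_ratio_fkWitness_one_le hv.1 _
    (Summit.AtomisticToContinuum.BoseEinsteinCondensation.Theorems.TwoReplicaTransienceBound.Negative.fkNormSq_one_ne_zero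
      (N := n + 1) hv.1 hC hL two_pos)

/-- **`∀ n` upgrade of the crux for bounded potentials**: if `TwoReplicaTransienceBound` holds then, for
every admissible bounded `v` and small `ρ`, ONE constant serves ALL particle numbers `n` and all
`T ≥ 1` (the eventual constant of the crux, maxed with the finitely many per-box constants below the
threshold). [folklore] -/
theorem twoReplicaTransienceBound_allN_of_bounded
    (h : Summit.AtomisticToContinuum.BoseEinsteinCondensation.Theses.BECCutLineWeakDisorder.TwoReplicaTransienceBound)
    (v : ℝ → ℝ≥0∞) (hv : IsRepulsiveFiniteRange v) (hb : ∃ C : ℝ≥0, ∀ r, v r ≤ C) :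
    ∃ ρ₀ : ℝ, 0 < ρ₀ ∧ ∀ ρ : ℝ, 0 < ρ → ρ < ρ₀ → ∃ C : ℝ, 0 < C ∧ ∀ n : ℕ, ∀ T : ℝ, 1 ≤ T →
      ∫⁻ Y : Config n, ENNReal.ofReal (sideLength ρ (n + 1) ^ 3) *
          (∫⁻ x, (‖fkWitness (N := n + 1) v (sideLength ρ (n + 1)) T (fun _ => (1 : ℝ≥0∞))
            (Matrix.vecCons x Y)‖₊ : ℝ≥0∞) ^ 2) ^ 2 /
          (∫⁻ x, (‖fkWitness (N := n + 1) v (sideLength ρ (n + 1)) T (fun _ => (1 : ℝ≥0∞))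
            (Matrix.vecCons x Y)‖₊ : ℝ≥0∞)) ^ 2 ≤ ENNReal.ofReal C := by
  obtain ⟨ρ₀, hρ₀, H⟩ := h v hv
  refine ⟨ρ₀, hρ₀, fun ρ hρ hρlt => ?_⟩
  obtain ⟨C, hC, hev⟩ := H ρ hρ hρlt
  obtain ⟨n₀, hn₀⟩ := Filter.eventually_atTop.1 hev
  -- per-box constants below the threshold
  choose c hc hcT using fun n : ℕ => twoReplicaTransienceBound_perBox v hv hb hρ n
  refine ⟨max C (∑ k ∈ Finset.range n₀, c k), lt_max_of_lt_left hC, fun n T hT => ?_⟩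
  rcases le_or_gt n₀ n with hn | hn
  · exact (hn₀ n hn T hT).trans (ENNReal.ofReal_le_ofReal (le_max_left _ _))
  · refine (hcT n T hT).trans (ENNReal.ofReal_le_ofReal ((?_ : c n ≤ _).trans (le_max_right _ _)))
    exact Finset.single_le_sum (fun k _ => (hc k).le) (Finset.mem_range.2 hn)

end Summit.AtomisticToContinuum.BoseEinsteinCondensation.Cruxes.TwoReplicaTransienceBound.PerBox

namespace Summit.AtomisticToContinuum.BoseEinsteinCondensation.Cruxes.TwoReplicaTransienceBound.TracerDecoupling

open Literature.MathematicalPhysics.QuantumManyBody.BoseGas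

/-- **Registered toolbox stub `stub_perBoxBound`** (crux stmt-AtomisticToContinuum-9687, line
`SketchIdeator1`): the crux's integral is bounded uniformly in `T ≥ 1` in EVERY FIXED BOX, for every
admissible bounded pair potential, every density `ρ > 0` and every particle number `n`
(`= PerBox.twoReplicaTransienceBound_perBox`; the crux itself asks for one constant eventually in `n`). -/
theorem stub_perBoxBound :
    ∀ (v : ℝ → ENNReal), IsRepulsiveFiniteRange v → (∃ C : NNReal, ∀ r, v r ≤ C) →
      ∀ (ρ : ℝ), 0 < ρ → ∀ (n : ℕ), ∃ C : ℝ, 0 < C ∧ ∀ T : ℝ, 1 ≤ T →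
        ∫⁻ Y : Config n, ENNReal.ofReal (sideLength ρ (n + 1) ^ 3) *
            (∫⁻ x, (‖@fkWitness (n + 1) v (sideLength ρ (n + 1)) T (fun _ => (1 : ENNReal))
              (Matrix.vecCons x Y)‖₊ : ENNReal) ^ 2) ^ 2 /
            (∫⁻ x, (‖@fkWitness (n + 1) v (sideLength ρ (n + 1)) T (fun _ => (1 : ENNReal))
              (Matrix.vecCons x Y)‖₊ : ENNReal)) ^ 2 ≤ ENNReal.ofReal C := by
  intro v hv hb ρ hρ n
  exact PerBox.twoReplicaTransienceBound_perBox v hv hb hρ n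

end Summit.AtomisticToContinuum.BoseEinsteinCondensation.Cruxes.TwoReplicaTransienceBound.TracerDecoupling

end
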